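import Summits.Ventures.LatticeQCDFlow.Scoring.SchwingerDysonOnePlaquette
import Literature.Analysis.FunctionSpaces.BesselIRecurrence
import HarnessLib

/-!
# The SU(2) one-plaquette character coefficients: `c_j(β) = I_{2j}(β) − I_{2j+2}(β) = 2(2j+1) I_{2j+1}(β)/β`

HONEST FRAMING: exact (Metropolis-corrected) sampling algorithms for lattice gauge theory;
figures of merit are autocorrelation/cost numbers at stated couplings and volumes; no
continuum-physics claim.

Venture `LatticeQCDFlow` (cell pub-lqcd), sub-topic `Scoring`; FANOUT row 5 (`s0-sun-a`), GEN-7.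
NEW WORK of the cell (placement rule).  In the class angle `α` of `Scoring/SchwingerDysonOnePlaquette.lean`
(`½ tr U = cos α`, reduced Haar weight `(2/π) sin² α` on `[0, π]`, Wilson weight `e^{β cos α}`), the
SU(2) characters are `χ_j(α) = sin((2j+1)α)/sin α` (`j = 0, ½, 1, …`; here `2j ∈ ℕ` is the index
`k`), and the character coefficients of the Wilson weight,
`c_k(β) = (2/π) ∫₀^π χ_{k/2}(α) sin² α e^{β cos α} dα = (2/π) ∫₀^π sin((k+1)α) sin α e^{β cos α} dα`,
are

* **`su2CharCoeff_eq_besselI_sub`** `(2/π) ∫₀^π sin((k+1)α) sin α e^{β cos α} dα = I_k(β) − I_{k+2}(β)`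
  (product-to-sum `2 sin((k+1)α) sin α = cos kα − cos (k+2)α` and the defining integral of the
  tree's `besselI`), and, by the recurrence DLMF 10.29.1
  (`Literature/Analysis/FunctionSpaces/BesselIRecurrence.lean`),
* **`beta_mul_su2CharCoeff`** `β (I_k(β) − I_{k+2}(β)) = 2(k+1) I_{k+1}(β)`, i.e.
  `c_k(β) = 2(k+1) I_{k+1}(β)/β` — the closed form the cell's exact SU(2) oracle uses
  (ORACLE-X02 / row 5 ORACLE-TABLE §1, validation V1: `d_j λ_j = I_{2j} − I_{2j+2} = 2(2j+1) I_{2j+1}/β`);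
* `onePlaquetteZSU2_eq` — the `k = 0` case is the one-plaquette normalisation
  `Z₂(β) = ∫₀^π sin² α e^{β cos α} dα = (π/2)(I₀(β) − I₂(β))`.

NOT here: the SU(2) finite-torus formula `Z_V = Σ_j (c_{2j}/(2j+1))^V (2j+1)^2…` (needs the
non-abelian lattice integration), Peter–Weyl.
-/

noncomputable section

open Real MeasureTheory intervalIntegral Literature.Analysis.FunctionSpaces

namespace Summit.Ventures.LatticeQCDFlow.Scoring

/-- **SU(2) character coefficients of the Wilson weight**:
`(2/π) ∫₀^π sin((k+1)α) sin α e^{β cos α} dα = I_k(β) − I_{k+2}(β)`. -/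
theorem su2CharCoeff_eq_besselI_sub (k : ℕ) (β : ℝ) :
    2 / π * ∫ α in (0 : ℝ)..π, Real.sin ((k + 1) * α) * Real.sin α * Real.exp (β * Real.cos α) =
      besselI k β - besselI (k + 2) β := by
  have hc : ∀ m : ℕ, Continuous fun α : ℝ => Real.exp (β * Real.cos α) * Real.cos (m * α) := fun m => by
    fun_prop
  have hπ : (π : ℝ) ≠ 0 := Real.pi_ne_zero
  rw [← mul_left_cancel_iff_of_pos Real.pi_pos, mul_sub, ← integral_exp_mul_cos_mul_cos_nat,
    ← integral_exp_mul_cos_mul_cos_nat,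
    ← intervalIntegral.integral_sub ((hc k).intervalIntegrable _ _) ((hc (k + 2)).intervalIntegrable _ _),
    ← mul_assoc, show π * (2 / π) = 2 by field_simp, ← intervalIntegral.integral_const_mul]
  refine intervalIntegral.integral_congr fun α _ => ?_
  have h := Real.two_mul_sin_mul_sin ((k + 1) * α) α
  rw [show ((k : ℝ) + 1) * α - α = k * α by ring, show ((k : ℝ) + 1) * α + α = ((k + 2 : ℕ) : ℝ) * α by
    push_cast; ring] at h
  calc 2 * (Real.sin ((k + 1) * α) * Real.sin α * Real.exp (β * Real.cos α))
      = (2 * Real.sin ((k + 1) * α) * Real.sin α) * Real.exp (β * Real.cos α) := by ring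
    _ = _ := by rw [h]; ring

/-- **Closed form by the Bessel recurrence**: `β (I_k(β) − I_{k+2}(β)) = 2(k+1) I_{k+1}(β)`, i.e. the
SU(2) character coefficient is `c_k(β) = 2(k+1) I_{k+1}(β)/β` (`β ≠ 0`). -/
theorem beta_mul_su2CharCoeff (k : ℕ) (β : ℝ) :
    β * (2 / π * ∫ α in (0 : ℝ)..π, Real.sin ((k + 1) * α) * Real.sin α * Real.exp (β * Real.cos α)) =
      2 * (k + 1) * besselI (k + 1) β := by
  rw [su2CharCoeff_eq_besselI_sub, mul_besselI_sub_besselI_add_two]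

/-- The `k = 0` coefficient is the one-plaquette normalisation:
`Z₂(β) = ∫₀^π sin² α e^{β cos α} dα = (π/2) (I₀(β) − I₂(β))`. -/
theorem onePlaquetteZSU2_eq (β : ℝ) : onePlaquetteZSU2 β = π / 2 * (besselI 0 β - besselI 2 β) := by
  have h := su2CharCoeff_eq_besselI_sub 0 β
  simp only [Nat.cast_zero, zero_add, one_mul] at h
  rw [← h, onePlaquetteZSU2]
  have hπ : (π : ℝ) ≠ 0 := Real.pi_ne_zero
  rw [← mul_assoc, show π / 2 * (2 / π) = 1 by field_simp, one_mul]
  refine intervalIntegral.integral_congr fun α _ => ?_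
  ring

end Summit.Ventures.LatticeQCDFlow.Scoring
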